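import Summits.BirchSwinnertonDyer.BirchSwinnertonDyer.Theorems.SignedLowerHalvesSmallImageLowerHalfBothSignsRttD2AuxIdealWitness
import Summits.BirchSwinnertonDyer.BirchSwinnertonDyer.Theorems.SignedLowerHalvesSmallImageLowerHalfBothSignsRttCharRoadE1ResidualCharacter
import Literature.NumberTheory.QuadraticFields.RingClassNumberFormula
import Literature.NumberTheory.LFunctions.RayClassCharacter
import Literature.NumberTheory.GaloisRepresentations.IntegralGaloisActionProofs
import Mathlib.NumberTheory.LSeries.PrimesInAP
import HarnessLib

/-!
# Route `SignedLowerHalves`, crux L `SmallImageLowerHalfBothSigns` (stmt-BirchSwinnertonDyer-23599), line `rtt_w3` v14 — E2, row «𝔞-ram» (LEAD, RULING «U»):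
# THE RESIDUAL WITNESS FOR THE FRAME'S CHARACTER `θ* = θ_ψ⁻¹` (RAMIFIED AT `p`) IS A FROBENIUS AT AN INERT PRIME `ℓ ≡ 1 (mod p)`

WHY (HOME STATUS 2026-08-30T18:27Z RULING «U» + ERRATUM; HELPER-TABLE addendum 9 row «𝔞-ram»). Under «U» the two-variable datum carries `θ* := θ_ψ⁻¹`, whose
finite-order part `χ₀` is RAMIFIED at the inert `p` (Teichmüller component), so the tame witness of p782069 (`𝔣 ⊄ w`) is idle; honda's supply p781713 still
reduces row «𝔞» to ONE `g ∈ Γ_K` with `χ_p(g)·θ(g) − 1 ∈ 𝒪ˣ`. THIS FILE produces it from the REGISTERED STUB's binders alone, with `g` an arithmetic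
FROBENIUS: by Dirichlet (Mathlib `Nat.forall_exists_prime_gt_and_eq_mod`) pick a prime `ℓ ≡ p (mod 4|d_K|)`, `ℓ ≡ 1 (mod p)`, `ℓ > N𝔪`; then
`(d_K/ℓ) = (d_K/p) = −1` (`jacobiSym.mod_right`; `(d_K/p) = −1` because `p` is inert, tree `isPrime_span_natCast_iff_jacobiSym_eq_neg_one`), so `(ℓ)` is a
prime `w` of `K` with `N w = ℓ²`, `p ∉ w`, `𝔪 ⊄ w`; the stub's centrality clause `hψpow` gives `ψ(w) = ψ((ℓ)) = (d_K/ℓ)·ℓ = −ℓ`, the pin `hθ` gives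
`θ(Frob_w)₀₀ = e⁻¹(ψ w) = −ℓ` (`coe_apply_eq_of_hasFrobCharpolyAt`), and `χ_p(Frob_w) = N w = ℓ²` (`GaloisRep.cyclotomicCharacter_apply_of_isArithFrobAt`); hence for
the INVERSE character `θ'` (`θ'(g)·θ(g)₀₀ = 1`, i.e. `θ' = θ*`): `(χ_p·θ' − 1)(Frob_w)·(−ℓ) = ℓ² + ℓ = ℓ(ℓ+1) ∈ 𝒪ˣ` (`p ∤ ℓ(ℓ+1)` as `ℓ ≡ 1`, `p` odd).
A character congruent to `θ'` modulo `𝔪_𝒪` (the finite-order part `χ₀ = θ*·η⁻¹`, `η ≡ 1`) has the same witness.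

* `exists_prime_jacobiSym_eq_neg_one_modEq_one` — the Dirichlet prime (pure arithmetic);
* `natCast_dvd_absNorm_of_le_span` — `I ⊆ (ℓ) ⟹ ℓ ∣ N(I)` in a quadratic field (the inert place `w = (ℓ)`: `p ∉ w`, `𝔪 ⊄ w`);
* `isUnit_natCast_padicCoeffIntegers_of_not_dvd` — `p ∤ n ⟹ (n : 𝒪) ∈ 𝒪ˣ`;
* ★★★ `exists_isUnit_cyclotomicCharacter_mul_inv_sub_one` — the witness for `θ'` with `θ'(g)·θ(g)₀₀ = 1` (= `hg` of p781713 for the frame's `θ*`);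
* ★★★ `exists_isUnit_cyclotomicCharacter_mul_entry_sub_one` — the same for `θ'(g) = θ(g)₀₀` (`θ_ψ` itself: `−(ℓ³ + 1) ∈ 𝒪ˣ`);
* ★★ `exists_isUnit_cyclotomicCharacter_mul_sub_one_of_congr` — the same for any `θ''` with `θ''(g) − θ'(g) ∈ 𝔪_𝒪` (the finite-order part `χ₀`).

THEOREMS ONLY (`--supports stmt-BirchSwinnertonDyer-23599` helper); closes nothing; crux L, crux M, E2 and BSD remain OPEN and are proved for NO curve by any of this.
[cite: SerreAbelianLadic1968, Ch. I §1.2 (χ_ℓ(Frob_v) = Nv) and §2.3] [cite: Cox2013, §5.B Prop. 5.16 (p. 105)] [cite: NeukirchANT1999, Ch. VII §13 (Čebotarev/Dirichlet)]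
[cite: JohnsonLeungKings2011, §5.1 (arXiv p0014:L12–43)]
-/

set_option autoImplicit false
-- the Theorems namespace of this sub repeats the summit name by design (D-0017 nested layout)
set_option linter.dupNamespace false

noncomputable section

open scoped NumberField
open Field IsDedekindDomain NumberField Polynomial
open Literature.NumberTheory.GaloisRepresentations
open Literature.NumberTheory.EllipticCurves
open Literature.NumberTheory.LFunctions (idealPow idealPow_asIdeal)
open Literature.NumberTheory.QuadraticFields.RingClass (isPrime_span_natCast_iff_jacobiSym_eq_neg_one)
open Summit.BirchSwinnertonDyer.BirchSwinnertonDyer.Theorems.SmallImageRttCharRoad (coe_apply_eq_of_hasFrobCharpolyAt)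

namespace Summit.BirchSwinnertonDyer.BirchSwinnertonDyer.Theorems.SmallImageRttD2AuxIdeal

/-! ## §1 A Dirichlet prime `ℓ ≡ p (mod 4|d|)`, `ℓ ≡ 1 (mod p)` -/

/-- **A prime `ℓ > N` with `(d/ℓ) = (d/p)`, `ℓ ≡ 1 (mod p)`, `ℓ ∤ d`, `p ∤ ℓ`**, for `p` an odd prime with `p ∤ d ≠ 0` (Dirichlet's theorem in the class of the
CRT solution of `x ≡ p (mod 4|d|)`, `x ≡ 1 (mod p)`; `jacobiSym.mod_right`). [cite: NeukirchANT1999, Ch. VII §13] [folklore] -/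
theorem exists_prime_jacobiSym_eq_modEq_one {p : ℕ} (hp : p.Prime) (hp2 : p ≠ 2) {d : ℤ} (hd : d ≠ 0) (hpd : ¬ (p : ℤ) ∣ d) (N : ℕ) :
    ∃ ℓ : ℕ, ℓ.Prime ∧ N < ℓ ∧ ℓ ≠ 2 ∧ jacobiSym d ℓ = jacobiSym d p ∧ ℓ ≡ 1 [MOD p] ∧ ¬ (ℓ : ℤ) ∣ d ∧ ¬ p ∣ ℓ := by
  have hp1 : 1 < p := hp.one_lt
  have hpodd : Odd p := hp.odd_of_ne_two hp2
  set M : ℕ := 4 * d.natAbs with hM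
  have hM0 : M ≠ 0 := by
    rw [hM]; exact mul_ne_zero (by norm_num) (Int.natAbs_ne_zero.mpr hd)
  have hcopMp : M.Coprime p := by
    rw [hM]
    refine Nat.Coprime.mul_left ?_ ?_
    · have h2p : Nat.Coprime 2 p := (Nat.coprime_primes Nat.prime_two hp).mpr (Ne.symm hp2)
      simpa using h2p.pow_left 2
    · exact Nat.coprime_comm.mp ((Nat.Prime.coprime_iff_not_dvd hp).mpr fun h ↦ hpd (Int.natCast_dvd.mpr h))
  obtain ⟨x, hxM, hxp⟩ := Nat.chineseRemainder hcopMp p 1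
  have hxunit : IsUnit ((x : ℕ) : ZMod (M * p)) := by
    rw [ZMod.isUnit_iff_coprime]
    refine Nat.Coprime.mul_right ?_ ?_
    · exact hxM.gcd_eq.trans (Nat.coprime_comm.mp hcopMp)
    · exact hxp.gcd_eq.trans (Nat.gcd_one_left p)
  haveI : NeZero (M * p) := ⟨mul_ne_zero hM0 hp.ne_zero⟩
  obtain ⟨ℓ, hℓN, hℓ, hℓx⟩ := Nat.forall_exists_prime_gt_and_eq_mod hxunit (N + 2)
  have hℓx' : ℓ ≡ x [MOD M * p] := (ZMod.natCast_eq_natCast_iff _ _ _).mp hℓx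
  have hℓM : ℓ ≡ p [MOD M] := (hℓx'.of_mul_right p).trans hxM
  have hℓp : ℓ ≡ 1 [MOD p] := (hℓx'.of_mul_left M).trans hxp
  have hℓ2 : ℓ ≠ 2 := by omega
  have hℓodd : Odd ℓ := hℓ.odd_of_ne_two hℓ2
  have hpℓ : ¬ p ∣ ℓ := by
    rintro ⟨c, hc⟩
    have h1 : ℓ % p = 1 % p := hℓp
    rw [hc, Nat.mul_mod_right, Nat.mod_eq_of_lt hp1] at h1
    exact zero_ne_one h1
  refine ⟨ℓ, hℓ, by omega, hℓ2, ?_, hℓp, ?_, hpℓ⟩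
  · rw [jacobiSym.mod_right d hℓodd, jacobiSym.mod_right d hpodd, ← hM]
    exact congrArg (jacobiSym d) hℓM
  · intro hdvd
    have h1 : ℓ ∣ M := Dvd.dvd.mul_left (Int.natCast_dvd.mp hdvd) 4
    have h2 : ℓ ≡ p [MOD ℓ] := hℓM.of_dvd h1
    have h3 : ℓ ∣ p := by
      have h4 : p % ℓ = 0 := by
        have h5 : ℓ % ℓ = p % ℓ := h2
        rw [← h5]; exact Nat.mod_self ℓ
      exact Nat.dvd_of_mod_eq_zero h4
    have h6 : ℓ = p := (Nat.prime_dvd_prime_iff_eq hℓ hp).mp h3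
    exact hpℓ (by rw [h6])

/-! ## §2 The inert place `(ℓ)` of the quadratic field -/

section Inert

variable {K : Type} [Field K] [NumberField K]

/-- `I ⊆ (ℓ) ⟹ ℓ ∣ N(I)` in a quadratic field. [folklore] -/
theorem natCast_dvd_absNorm_of_le_span (hK2 : Module.finrank ℚ K = 2) (ℓ : ℕ) {I : Ideal (𝓞 K)}
    (h : I ≤ Ideal.span {(ℓ : 𝓞 K)}) : ℓ ∣ Ideal.absNorm I := by
  have h1 := Ideal.absNorm_dvd_absNorm_of_le h
  rw [Ideal.absNorm_span_natCast, NumberField.RingOfIntegers.rank, hK2] at h1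
  exact (dvd_pow_self ℓ two_ne_zero).trans h1

end Inert

/-! ## §3 The witness -/

section Witness

variable {p : ℕ} [Fact p.Prime] (S : Set (PadicAlgCl p))

/-- `p ∤ n ⟹ (n : 𝒪) ∈ 𝒪ˣ` (`𝒪 = 𝒪_{ℚ_p(S)}`; through `ℤ_p → 𝒪`). [folklore] -/
theorem isUnit_natCast_padicCoeffIntegers_of_not_dvd {n : ℕ} (hn : ¬ p ∣ n) : IsUnit ((n : ℕ) : padicCoeffIntegers S) := by
  have h : IsUnit ((n : ℤ) : ℤ_[p]) := by
    rw [PadicInt.isUnit_iff]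
    refine le_antisymm (PadicInt.norm_le_one _) (not_lt.mp fun hlt ↦ hn ?_)
    have h1 := (PadicInt.norm_int_lt_one_iff_dvd (n : ℤ)).mp hlt
    exact_mod_cast h1
  have h2 := h.map (padicIntToCoeffIntegers S)
  rwa [Int.cast_natCast, map_natCast] at h2

variable {K : Type} [Field K] [NumberField K]

/-- ★★★ **The residual witness for the inverse character, from the registered stub's binders.** `K` quadratic with `p ∤ d_K` (`hnd`), `p` odd and INERT
(`hinert`), `ψ` a map on the places with the centrality clause `hψpow` (`ψ((n)) = (d_K/n)·n` for odd `n` prime to `d_K·N𝔪`), `θ` the pinned integral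
character (`hθ`: arithmetic-Frobenius polynomial `X − C(e⁻¹ψ(w))` at `w ∤ p𝔪`), and `θ' : Γ_K → 𝒪ˣ` with `θ'(g)·θ(g)₀₀ = 1` (the frame's `θ* = θ_ψ⁻¹`). Then some
`g ∈ Γ_K` has `χ_p(g)·θ'(g) − 1 ∈ 𝒪ˣ` — namely an arithmetic Frobenius at the inert place `(ℓ)`, `ℓ ≡ p (4|d_K|)`, `ℓ ≡ 1 (p)`, `ℓ > N𝔪`:
`(χ_p θ' − 1)(Frob)·θ(Frob)₀₀ = ℓ² + ℓ ∈ 𝒪ˣ`. This is the hypothesis `hg` of honda's `exists_auxIdeal_isUnit_map_nsub` (p781713) for the frame character of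
RULING «U». [cite: SerreAbelianLadic1968, Ch. I §1.2 and §2.3] [cite: Cox2013, §5.B Prop. 5.16 (p. 105)] [cite: JohnsonLeungKings2011, §5.1 (arXiv p0014:L12–43)] -/
theorem exists_isUnit_cyclotomicCharacter_mul_inv_sub_one (hK2 : Module.finrank ℚ K = 2) (hp2 : p ≠ 2)
    (hnd : ¬ (p : ℤ) ∣ NumberField.discr K) {𝔪 : Ideal (𝓞 K)} (h𝔪 : 𝔪 ≠ ⊥)
    (hinert : ∃ v : HeightOneSpectrum (𝓞 K), v.asIdeal = Ideal.span {((p : ℕ) : 𝓞 K)} ∧ Nat.card (𝓞 K ⧸ v.asIdeal) = p ^ 2)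
    (ψ : HeightOneSpectrum (𝓞 K) → ℂ) (e : PadicAlgCl p ≃+* ℂ)
    (hψpow : ∀ n : ℕ, Odd n → n.Coprime ((NumberField.discr K).natAbs * Ideal.absNorm 𝔪) →
      idealPow K ψ (Ideal.span {(n : 𝓞 K)}) = (jacobiSym (NumberField.discr K) n : ℂ) * (n : ℂ) ^ (2 - 1))
    (θ : FramedGaloisRep K (padicCoeffIntegers S) 1)
    (hθ : ∀ w : HeightOneSpectrum (𝓞 K), (p : 𝓞 K) ∉ w.asIdeal → ¬ 𝔪 ≤ w.asIdeal →
      θ.IsUnramifiedAt w ∧ ∃ P : Polynomial (padicCoeffIntegers S),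
        P.map (padicCoeffIntegers S).subtype = X - C (e.symm (ψ w)) ∧ θ.HasFrobCharpolyAt w P)
    (θ' : absoluteGaloisGroup K →ₜ* (padicCoeffIntegers S)ˣ)
    (hθ' : ∀ g : absoluteGaloisGroup K, ((θ' g : (padicCoeffIntegers S)ˣ) : padicCoeffIntegers S) *
      ((θ g : GL (Fin 1) (padicCoeffIntegers S)) : Matrix (Fin 1) (Fin 1) (padicCoeffIntegers S)) 0 0 = 1) :
    ∃ g : absoluteGaloisGroup K, IsUnit (padicIntToCoeffIntegers S ((GaloisRep.cyclotomicCharacter K p g : ℤ_[p]ˣ) : ℤ_[p]) *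
      ((θ' g : (padicCoeffIntegers S)ˣ) : padicCoeffIntegers S) - 1) := by
  classical
  have hp : p.Prime := Fact.out
  obtain ⟨v, hv, -⟩ := hinert
  -- `(d_K/p) = −1`: `p` is inert
  have hJp : jacobiSym (NumberField.discr K) p = -1 := by
    refine (isPrime_span_natCast_iff_jacobiSym_eq_neg_one hK2 hp hp2).mp ?_
    rw [← hv]; exact v.isPrime
  have hpos : 0 < Ideal.absNorm 𝔪 := Nat.pos_of_ne_zero (mt Ideal.absNorm_eq_zero_iff.mp h𝔪)
  obtain ⟨ℓ, hℓ, hℓN, hℓ2, hJℓ, hℓ1, hℓd, hpℓ⟩ :=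
    exists_prime_jacobiSym_eq_modEq_one hp hp2 (NumberField.discr_ne_zero K) hnd (Ideal.absNorm 𝔪)
  rw [hJp] at hJℓ
  -- the inert place `w = (ℓ)`
  have hprime : (Ideal.span {(ℓ : 𝓞 K)}).IsPrime := (isPrime_span_natCast_iff_jacobiSym_eq_neg_one hK2 hℓ hℓ2).mpr hJℓ
  have hne : Ideal.span {(ℓ : 𝓞 K)} ≠ ⊥ := by
    rw [Ne, Ideal.span_singleton_eq_bot]; exact_mod_cast hℓ.ne_zero
  let w : HeightOneSpectrum (𝓞 K) := ⟨Ideal.span {(ℓ : 𝓞 K)}, hprime, hne⟩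
  have hwℓ : w.asIdeal = Ideal.span {(ℓ : 𝓞 K)} := rfl
  have hpw : ((p : ℕ) : 𝓞 K) ∉ w.asIdeal := by
    intro hmem
    have hle : Ideal.span {((p : ℕ) : 𝓞 K)} ≤ Ideal.span {(ℓ : 𝓞 K)} := (Ideal.span_singleton_le_iff_mem _).mpr hmem
    have h1 := natCast_dvd_absNorm_of_le_span hK2 ℓ hle
    rw [Ideal.absNorm_span_natCast, NumberField.RingOfIntegers.rank, hK2] at h1
    have h2 : ℓ = p := (Nat.prime_dvd_prime_iff_eq hℓ hp).mp (hℓ.dvd_of_dvd_pow h1)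
    exact hpℓ (by rw [h2])
  have h𝔪w : ¬ 𝔪 ≤ w.asIdeal := fun hle ↦
    Nat.not_dvd_of_pos_of_lt hpos hℓN (natCast_dvd_absNorm_of_le_span hK2 ℓ hle)
  -- an arithmetic Frobenius `F` at `w`, the pin, the cyclotomic value
  obtain ⟨-, P, hP, hFrob⟩ := hθ w hpw h𝔪w
  have h𝔔 := adicCompletionPrime_mem_primesAbove K w
  obtain ⟨F, hF⟩ := IsDedekindDomain.HeightOneSpectrum.exists_isArithFrobAt_of_mem_primesAbove_holds h𝔔
  have hval := coe_apply_eq_of_hasFrobCharpolyAt θ hP hFrob h𝔔 hF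
  have hψw : ψ w = -(ℓ : ℂ) := by
    have h1 : ψ w = idealPow K ψ (Ideal.span {(ℓ : 𝓞 K)}) := by rw [← hwℓ, idealPow_asIdeal]
    have hodd : Odd ℓ := hℓ.odd_of_ne_two hℓ2
    have hcop : ℓ.Coprime ((NumberField.discr K).natAbs * Ideal.absNorm 𝔪) :=
      Nat.Coprime.mul_right ((Nat.Prime.coprime_iff_not_dvd hℓ).mpr fun h ↦ hℓd (Int.natCast_dvd.mpr h))
        ((Nat.Prime.coprime_iff_not_dvd hℓ).mpr fun h ↦ Nat.not_dvd_of_pos_of_lt hpos hℓN h)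
    rw [h1, hψpow ℓ hodd hcop, hJℓ]
    push_cast
    ring
  set t : padicCoeffIntegers S := ((θ F : GL (Fin 1) (padicCoeffIntegers S)) : Matrix (Fin 1) (Fin 1) (padicCoeffIntegers S)) 0 0 with ht
  have ht' : t = -((ℓ : ℕ) : padicCoeffIntegers S) := by
    apply Subtype.ext
    rw [hval, hψw, map_neg, map_natCast]
    push_cast
    rfl
  have hχ : ((GaloisRep.cyclotomicCharacter K p F : ℤ_[p]ˣ) : ℤ_[p]) = ((ℓ ^ 2 : ℕ) : ℤ_[p]) := by
    rw [GaloisRep.cyclotomicCharacter_apply_of_isArithFrobAt hpw h𝔔 hF]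
    change ((Ideal.absNorm w.asIdeal : ℕ) : ℤ_[p]) = _
    rw [hwℓ, Ideal.absNorm_span_natCast, NumberField.RingOfIntegers.rank, hK2]
  refine ⟨F, ?_⟩
  have hθ'F : ((θ' F : (padicCoeffIntegers S)ˣ) : padicCoeffIntegers S) * t = 1 := hθ' F
  have key : (padicIntToCoeffIntegers S ((GaloisRep.cyclotomicCharacter K p F : ℤ_[p]ˣ) : ℤ_[p]) *
      ((θ' F : (padicCoeffIntegers S)ˣ) : padicCoeffIntegers S) - 1) * t =
        ((ℓ ^ 2 : ℕ) : padicCoeffIntegers S) + (ℓ : padicCoeffIntegers S) := by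
    rw [hχ, map_natCast, sub_mul, one_mul, mul_assoc, hθ'F, mul_one, ht', sub_neg_eq_add]
  have hpℓ1 : ¬ p ∣ ℓ + 1 := by
    rintro ⟨c, hc⟩
    have h1 : (ℓ + 1) % p = 2 % p := hℓ1.add_right 1
    rw [hc, Nat.mul_mod_right] at h1
    exact hp2 ((Nat.prime_dvd_prime_iff_eq hp Nat.prime_two).mp (Nat.dvd_of_mod_eq_zero h1.symm))
  have hunit : IsUnit (((ℓ ^ 2 : ℕ) : padicCoeffIntegers S) + (ℓ : padicCoeffIntegers S)) := by
    have h1 : ((ℓ ^ 2 : ℕ) : padicCoeffIntegers S) + (ℓ : padicCoeffIntegers S) = ((ℓ * (ℓ + 1) : ℕ) : padicCoeffIntegers S) := by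
      push_cast; ring
    rw [h1]
    exact isUnit_natCast_padicCoeffIntegers_of_not_dvd S fun h ↦ (hp.dvd_mul.mp h).elim hpℓ hpℓ1
  exact isUnit_of_mul_isUnit_left (by rw [key]; exact hunit)

/-- ★★★ **The same witness for the character `θ` ITSELF** (`θ'(g) = θ(g)₀₀`, i.e. `θ' = θ_ψ`, in case the frame carries `θ_ψ` rather than its inverse):
at the same Frobenius `χ_p·θ' − 1 = ℓ²·(−ℓ) − 1 = −(ℓ³ + 1)`, a unit since `ℓ³ + 1 ≡ 2 (mod p)`. [cite: SerreAbelianLadic1968, Ch. I §1.2 and §2.3]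
[cite: Cox2013, §5.B Prop. 5.16 (p. 105)] -/
theorem exists_isUnit_cyclotomicCharacter_mul_entry_sub_one (hK2 : Module.finrank ℚ K = 2) (hp2 : p ≠ 2)
    (hnd : ¬ (p : ℤ) ∣ NumberField.discr K) {𝔪 : Ideal (𝓞 K)} (h𝔪 : 𝔪 ≠ ⊥)
    (hinert : ∃ v : HeightOneSpectrum (𝓞 K), v.asIdeal = Ideal.span {((p : ℕ) : 𝓞 K)} ∧ Nat.card (𝓞 K ⧸ v.asIdeal) = p ^ 2)
    (ψ : HeightOneSpectrum (𝓞 K) → ℂ) (e : PadicAlgCl p ≃+* ℂ)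
    (hψpow : ∀ n : ℕ, Odd n → n.Coprime ((NumberField.discr K).natAbs * Ideal.absNorm 𝔪) →
      idealPow K ψ (Ideal.span {(n : 𝓞 K)}) = (jacobiSym (NumberField.discr K) n : ℂ) * (n : ℂ) ^ (2 - 1))
    (θ : FramedGaloisRep K (padicCoeffIntegers S) 1)
    (hθ : ∀ w : HeightOneSpectrum (𝓞 K), (p : 𝓞 K) ∉ w.asIdeal → ¬ 𝔪 ≤ w.asIdeal →
      θ.IsUnramifiedAt w ∧ ∃ P : Polynomial (padicCoeffIntegers S),
        P.map (padicCoeffIntegers S).subtype = X - C (e.symm (ψ w)) ∧ θ.HasFrobCharpolyAt w P)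
    (θ' : absoluteGaloisGroup K →ₜ* (padicCoeffIntegers S)ˣ)
    (hθ' : ∀ g : absoluteGaloisGroup K, ((θ' g : (padicCoeffIntegers S)ˣ) : padicCoeffIntegers S) =
      ((θ g : GL (Fin 1) (padicCoeffIntegers S)) : Matrix (Fin 1) (Fin 1) (padicCoeffIntegers S)) 0 0) :
    ∃ g : absoluteGaloisGroup K, IsUnit (padicIntToCoeffIntegers S ((GaloisRep.cyclotomicCharacter K p g : ℤ_[p]ˣ) : ℤ_[p]) *
      ((θ' g : (padicCoeffIntegers S)ˣ) : padicCoeffIntegers S) - 1) := by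
  classical
  have hp : p.Prime := Fact.out
  obtain ⟨v, hv, -⟩ := hinert
  have hJp : jacobiSym (NumberField.discr K) p = -1 := by
    refine (isPrime_span_natCast_iff_jacobiSym_eq_neg_one hK2 hp hp2).mp ?_
    rw [← hv]; exact v.isPrime
  have hpos : 0 < Ideal.absNorm 𝔪 := Nat.pos_of_ne_zero (mt Ideal.absNorm_eq_zero_iff.mp h𝔪)
  obtain ⟨ℓ, hℓ, hℓN, hℓ2, hJℓ, hℓ1, hℓd, hpℓ⟩ :=
    exists_prime_jacobiSym_eq_modEq_one hp hp2 (NumberField.discr_ne_zero K) hnd (Ideal.absNorm 𝔪)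
  rw [hJp] at hJℓ
  have hprime : (Ideal.span {(ℓ : 𝓞 K)}).IsPrime := (isPrime_span_natCast_iff_jacobiSym_eq_neg_one hK2 hℓ hℓ2).mpr hJℓ
  have hne : Ideal.span {(ℓ : 𝓞 K)} ≠ ⊥ := by
    rw [Ne, Ideal.span_singleton_eq_bot]; exact_mod_cast hℓ.ne_zero
  let w : HeightOneSpectrum (𝓞 K) := ⟨Ideal.span {(ℓ : 𝓞 K)}, hprime, hne⟩
  have hwℓ : w.asIdeal = Ideal.span {(ℓ : 𝓞 K)} := rfl
  have hpw : ((p : ℕ) : 𝓞 K) ∉ w.asIdeal := by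
    intro hmem
    have hle : Ideal.span {((p : ℕ) : 𝓞 K)} ≤ Ideal.span {(ℓ : 𝓞 K)} := (Ideal.span_singleton_le_iff_mem _).mpr hmem
    have h1 := natCast_dvd_absNorm_of_le_span hK2 ℓ hle
    rw [Ideal.absNorm_span_natCast, NumberField.RingOfIntegers.rank, hK2] at h1
    have h2 : ℓ = p := (Nat.prime_dvd_prime_iff_eq hℓ hp).mp (hℓ.dvd_of_dvd_pow h1)
    exact hpℓ (by rw [h2])
  have h𝔪w : ¬ 𝔪 ≤ w.asIdeal := fun hle ↦
    Nat.not_dvd_of_pos_of_lt hpos hℓN (natCast_dvd_absNorm_of_le_span hK2 ℓ hle)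
  obtain ⟨-, P, hP, hFrob⟩ := hθ w hpw h𝔪w
  have h𝔔 := adicCompletionPrime_mem_primesAbove K w
  obtain ⟨F, hF⟩ := IsDedekindDomain.HeightOneSpectrum.exists_isArithFrobAt_of_mem_primesAbove_holds h𝔔
  have hval := coe_apply_eq_of_hasFrobCharpolyAt θ hP hFrob h𝔔 hF
  have hψw : ψ w = -(ℓ : ℂ) := by
    have h1 : ψ w = idealPow K ψ (Ideal.span {(ℓ : 𝓞 K)}) := by rw [← hwℓ, idealPow_asIdeal]
    have hodd : Odd ℓ := hℓ.odd_of_ne_two hℓ2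
    have hcop : ℓ.Coprime ((NumberField.discr K).natAbs * Ideal.absNorm 𝔪) :=
      Nat.Coprime.mul_right ((Nat.Prime.coprime_iff_not_dvd hℓ).mpr fun h ↦ hℓd (Int.natCast_dvd.mpr h))
        ((Nat.Prime.coprime_iff_not_dvd hℓ).mpr fun h ↦ Nat.not_dvd_of_pos_of_lt hpos hℓN h)
    rw [h1, hψpow ℓ hodd hcop, hJℓ]
    push_cast
    ring
  have ht' : ((θ' F : (padicCoeffIntegers S)ˣ) : padicCoeffIntegers S) = -((ℓ : ℕ) : padicCoeffIntegers S) := by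
    rw [hθ' F]
    apply Subtype.ext
    rw [hval, hψw, map_neg, map_natCast]
    push_cast
    rfl
  have hχ : ((GaloisRep.cyclotomicCharacter K p F : ℤ_[p]ˣ) : ℤ_[p]) = ((ℓ ^ 2 : ℕ) : ℤ_[p]) := by
    rw [GaloisRep.cyclotomicCharacter_apply_of_isArithFrobAt hpw h𝔔 hF]
    change ((Ideal.absNorm w.asIdeal : ℕ) : ℤ_[p]) = _
    rw [hwℓ, Ideal.absNorm_span_natCast, NumberField.RingOfIntegers.rank, hK2]
  refine ⟨F, ?_⟩
  have key : padicIntToCoeffIntegers S ((GaloisRep.cyclotomicCharacter K p F : ℤ_[p]ˣ) : ℤ_[p]) *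
      ((θ' F : (padicCoeffIntegers S)ˣ) : padicCoeffIntegers S) - 1 = -(((ℓ ^ 3 + 1 : ℕ) : padicCoeffIntegers S)) := by
    rw [hχ, map_natCast, ht']
    push_cast
    ring
  have hpℓ3 : ¬ p ∣ ℓ ^ 3 + 1 := by
    rintro ⟨c, hc⟩
    have h1 : (ℓ ^ 3 + 1) % p = (1 ^ 3 + 1) % p := (hℓ1.pow 3).add_right 1
    rw [hc, Nat.mul_mod_right] at h1
    norm_num at h1
    exact hp2 ((Nat.prime_dvd_prime_iff_eq hp Nat.prime_two).mp (Nat.dvd_of_mod_eq_zero h1.symm))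
  rw [key]
  exact (isUnit_natCast_padicCoeffIntegers_of_not_dvd S hpℓ3).neg

omit [NumberField K] in
/-- ★★ **The witness transfers to any character congruent to `θ'` modulo `𝔪_𝒪`** (e.g. the finite-order part `χ₀ = θ*·η⁻¹`, `η ≡ 1`):
`χ_p(g)·θ''(g) − 1` differs from `χ_p(g)·θ'(g) − 1` by an element of `𝔪_𝒪`. [folklore] -/
theorem exists_isUnit_cyclotomicCharacter_mul_sub_one_of_congr [IsLocalRing (padicCoeffIntegers S)]
    (θ' θ'' : absoluteGaloisGroup K →ₜ* (padicCoeffIntegers S)ˣ)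
    (hcongr : ∀ g : absoluteGaloisGroup K, ((θ'' g : (padicCoeffIntegers S)ˣ) : padicCoeffIntegers S) -
      ((θ' g : (padicCoeffIntegers S)ˣ) : padicCoeffIntegers S) ∈ IsLocalRing.maximalIdeal (padicCoeffIntegers S))
    (h : ∃ g : absoluteGaloisGroup K, IsUnit (padicIntToCoeffIntegers S ((GaloisRep.cyclotomicCharacter K p g : ℤ_[p]ˣ) : ℤ_[p]) *
      ((θ' g : (padicCoeffIntegers S)ˣ) : padicCoeffIntegers S) - 1)) :
    ∃ g : absoluteGaloisGroup K, IsUnit (padicIntToCoeffIntegers S ((GaloisRep.cyclotomicCharacter K p g : ℤ_[p]ˣ) : ℤ_[p]) *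
      ((θ'' g : (padicCoeffIntegers S)ˣ) : padicCoeffIntegers S) - 1) := by
  obtain ⟨g, hg⟩ := h
  refine ⟨g, isUnit_of_sub_mem_maximalIdeal hg ?_⟩
  rw [show padicIntToCoeffIntegers S ((GaloisRep.cyclotomicCharacter K p g : ℤ_[p]ˣ) : ℤ_[p]) *
      ((θ'' g : (padicCoeffIntegers S)ˣ) : padicCoeffIntegers S) - 1 -
      (padicIntToCoeffIntegers S ((GaloisRep.cyclotomicCharacter K p g : ℤ_[p]ˣ) : ℤ_[p]) *
        ((θ' g : (padicCoeffIntegers S)ˣ) : padicCoeffIntegers S) - 1) =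
      padicIntToCoeffIntegers S ((GaloisRep.cyclotomicCharacter K p g : ℤ_[p]ˣ) : ℤ_[p]) *
        (((θ'' g : (padicCoeffIntegers S)ˣ) : padicCoeffIntegers S) - ((θ' g : (padicCoeffIntegers S)ˣ) : padicCoeffIntegers S)) by ring]
  exact Ideal.mul_mem_left _ _ (hcongr g)

end Witness

end Summit.BirchSwinnertonDyer.BirchSwinnertonDyer.Theorems.SmallImageRttD2AuxIdeal

end
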